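import Summits.Ventures.PercRepro2.CaseOneStarCfQtI22
import Summits.Ventures.PercRepro2.CaseOneStarCfQtI22Mono

/-!
# The marked star: the Bernstein coefficients of `cfQtI22` as combinations of the monomial coefficients (part A)
(blind cell PercRepro2, p1 g18; S5 §2.1 (K9) (q); OPS l.38 (i) — RULING (F) 2026-08-25T23:42:22Z)

The `(r, s)`-Bernstein coefficients `cBQtI22kl` of CaseOneStarCfQtI22.lean are integer combinations of the monomial
coefficients `aQtI22ij` (CaseOneStarCfQtI22Mono.lean): `cBQtI22kl = Σ_{i ≤ k, j ≤ l} c(k,i) c(l,j) aQtI22ij` with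
`c(k,i) = 3 · C(k,i) / C(3,i)` (`cBQtI22kl_eq`); for the index pairs without a Bernstein coefficient the combination
vanishes (`aQtI22vkl`). With the monomial expansion `cfQtI22_mono` the Bernstein identity `cfQtI22_bern'` — the SAME
statement as `cfQtI22_bern` — is a linear identity in `r`, `s` and the atoms `aQtI22ij m`; every step elaborates
on a referee node (the cell identities are spread over modules so that each file stays small in kernel memory). -/

namespace Summit.Ventures.PercRepro2

namespace CaseOne

section CfQtI22SplitA
variable {R : Type*} [CommRing R]

set_option maxHeartbeats 0 in
/-- `cBQtI2201` as an integer combination of the monomial coefficients. -/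
theorem cBQtI2201_eq (m : SCells R) :
    cBQtI2201 m = (3 : R) * aQtI2201 m := by
  unfold cBQtI2201 aQtI2201
  ring

set_option maxHeartbeats 0 in
/-- `cBQtI2202` as an integer combination of the monomial coefficients. -/
theorem cBQtI2202_eq (m : SCells R) :
    cBQtI2202 m = (6 : R) * aQtI2201 m + (3 : R) * aQtI2202 m := by
  unfold cBQtI2202 aQtI2201 aQtI2202
  ring

set_option maxHeartbeats 0 in
/-- The `(0,3)` Bernstein combination of the monomial coefficients vanishes (no `cBQtI2203`). -/
theorem aQtI22v03 (m : SCells R) :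
    (9 : R) * aQtI2201 m + (9 : R) * aQtI2202 m + (9 : R) * aQtI2203 m = 0 := by
  unfold aQtI2201 aQtI2202 aQtI2203
  ring

set_option maxHeartbeats 0 in
/-- `cBQtI2210` as an integer combination of the monomial coefficients. -/
theorem cBQtI2210_eq (m : SCells R) :
    cBQtI2210 m = (3 : R) * aQtI2210 m := by
  unfold cBQtI2210 aQtI2210
  ring

set_option maxHeartbeats 0 in
/-- `cBQtI2211` as an integer combination of the monomial coefficients. -/
theorem cBQtI2211_eq (m : SCells R) :
    cBQtI2211 m = (3 : R) * aQtI2201 m + (3 : R) * aQtI2210 m + (1 : R) * aQtI2211 m := by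
  unfold cBQtI2211 aQtI2201 aQtI2210 aQtI2211
  ring

set_option maxHeartbeats 0 in
/-- `cBQtI2212` as an integer combination of the monomial coefficients. -/
theorem cBQtI2212_eq (m : SCells R) :
    cBQtI2212 m = (6 : R) * aQtI2201 m + (3 : R) * aQtI2202 m + (3 : R) * aQtI2210 m + (2 : R) * aQtI2211 m + (1 : R) * aQtI2212 m := by
  unfold cBQtI2212 aQtI2201 aQtI2202 aQtI2210 aQtI2211 aQtI2212
  ring

set_option maxHeartbeats 0 in
/-- The `(1,3)` Bernstein combination of the monomial coefficients vanishes (no `cBQtI2213`). -/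
theorem aQtI22v13 (m : SCells R) :
    (9 : R) * aQtI2201 m + (9 : R) * aQtI2202 m + (9 : R) * aQtI2203 m + (3 : R) * aQtI2210 m + (3 : R) * aQtI2211 m + (3 : R) * aQtI2212 m + (3 : R) * aQtI2213 m = 0 := by
  unfold aQtI2201 aQtI2202 aQtI2203 aQtI2210 aQtI2211 aQtI2212 aQtI2213
  ring


end CfQtI22SplitA

end CaseOne

end Summit.Ventures.PercRepro2
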